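import Mathlib

/-!
# LeviBranchingFour — weight certificate for the `ℚ(i)`/`ℚ(√-2)`-balls of the T₈ face (solo-blind s47, sheets.md §8–§10)

On a `K'`-ball of the `U² ⊕ D₄(-1)` face (boundary surfaces `W₋ᵢ`, `W₋ⱼ`, `W_k`) the transcendental space
`T₈ ⊗ ℂ = W ⊕ W*` is the VECTOR representation of `𝔰𝔬₈` restricted to the Levi `GL(W)`, `W` the
4-dimensional `χ`-eigenspace, with Hodge cocharacter of charges `(2,0,0,0)` on `W` (`T_χ` has Hodge types
`(2,0)¹ (1,1)³`).  The two Kuga–Satake factors carry the half-spin representations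
`S_ev = Λ^{ev} W ⊗ det^{-1/2}` and `S_odd = Λ^{odd} W ⊗ det^{-1/2}`.  This file certifies the finite weight
bookkeeping used in PROPOSITION-SKETCH R8 (c) and THEOREM-SKETCH KSγ (all proofs `decide`):

* `T_K3type` : `W ⊕ W*` has charges `{2, 0⁶, -2}` (K3 type `(1,6,1)`);
* `ev_weightOne`, `odd_weightOne` : `S_ev` and `S_odd` have charges `{1⁴, (-1)⁴}` (weight-one type: the
  two Kuga–Satake 8-folds `A_±`, `H¹(A_±) ⊗ ℂ = S_± ⊗ ℂ²`);
* `ev_pieces` : inside `S_ev`, `Λ⁰` and `Λ⁴` are one-dimensional with charges `-1`, `+1` (two CM elliptic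
  curves `E'`) and `Λ² W ⊗ det^{-1/2}` has charges `{1³, (-1)³}` — an abelian SIXFOLD `B''` on which `K'`
  acts with signature `(3,3)`: WEIL TYPE; so `A_ev ~ E' × B'' × E'`;
* `odd_pieces` : inside `S_odd`, `Λ¹` has charges `{1, (-1)³}` (the `U(1,3)` fourfold `B'`) and `Λ³` has
  charges `{1³, -1}` (its twist `B'^{tw} ≅ W* ⊗ det`, signature `(3,1)`); so `A_odd ~ B' × B'^{tw}`;
* `weil_sixfold_signature` : `B' ⊕ E' ⊕ E'` has `K'`-signature `(1,3) + (1,0) + (1,0) = (3,3)`;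
* `det_signs` : for the hermitian form `H_T = ⟨1,-1,-1,-1⟩` one has `det H_T = -1`,
  `det Λ² H_T = ∏_{i<j} h_i h_j = -1` and `det (H_T ⊕ ⟨1,1⟩) = -1`: both sixfolds have discriminant `-1`
  (the case covered by Markman 2025, Thm 1.5.1);
* `torus_primitive` : the character `(1,1,1,1,2)` of `𝔾_m⁵` (the relation `det g · u² = 1` cutting out
  `Hg(B' × E')`) is unimodular, so the subgroup it defines is connected.

Charges are doubled where a half-integer twist `det^{-1/2}` occurs (we work with `2·charge`).  The
representation theory (half-spin modules of `𝔰𝔬(W ⊕ W*)`, van Geemen's half twist, FFT) stays on paper.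
-/

namespace Summit.HodgeConjecture.HodgeConjecture.Theorems.LeviBranchingFour

/-- A weight of the maximal torus of `GL(W)`, `W` four-dimensional, as a coefficient vector. -/
abbrev Wt := List ℤ

/-- The basis weights `e₁,…,e₄` of `W`. -/
def wW : List Wt := [[1,0,0,0], [0,1,0,0], [0,0,1,0], [0,0,0,1]]

/-- Coordinatewise sum of a list of weights (of length 4). -/
def wsum (l : List Wt) : Wt := l.foldr (fun a b => List.zipWith (· + ·) a b) [0,0,0,0]

/-- Negative of a weight. -/
def wneg (a : Wt) : Wt := a.map (fun x => -x)

/-- Twice the Hodge charge of a weight: the cocharacter has charges `(2,0,0,0)` on `W`, so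
`2·charge(Σ cᵢeᵢ) = 2·(2c₁) = 4c₁`; we record `2·charge` to absorb the twist `det^{-1/2}` (charge `-1`). -/
def twoCharge (a : Wt) : ℤ := 4 * a.headD 0

/-- Twice the charge of `det^{-1/2}`: `det W` has charge `2`, so `det^{-1/2}` has charge `-1`, doubled `-2`. -/
def twistHalf : ℤ := -2

/-- Weights of `Λᵏ W` as sums over `k`-element sublists. -/
def wLam (k : ℕ) : List Wt := (wW.sublists.filter fun s => s.length = k).map wsum

/-- Doubled charges of `Λᵏ W ⊗ det^{-1/2}`. -/
def chLamTw (k : ℕ) : List ℤ := (wLam k).map fun a => twoCharge a + twistHalf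

/-- Doubled charges of the vector representation `W ⊕ W*`. -/
def chT : List ℤ := (wW.map twoCharge) ++ (wW.map fun a => twoCharge (wneg a))

/-- `T ⊗ ℂ = W ⊕ W*` is of K3 type: doubled charges `{4, 0⁶, -4}`, i.e. Hodge numbers `(1,6,1)`. -/
theorem T_K3type : chT.length = 8 ∧ chT.count 4 = 1 ∧ chT.count 0 = 6 ∧ chT.count (-4) = 1 := by decide

/-- `S_ev = (Λ⁰ ⊕ Λ² ⊕ Λ⁴) W ⊗ det^{-1/2}` has dimension `1+6+1 = 8` and doubled charges `{2⁴, (-2)⁴}`: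
weight-one type. -/
theorem ev_weightOne :
    (chLamTw 0 ++ chLamTw 2 ++ chLamTw 4).length = 8 ∧
    (chLamTw 0 ++ chLamTw 2 ++ chLamTw 4).count 2 = 4 ∧
    (chLamTw 0 ++ chLamTw 2 ++ chLamTw 4).count (-2) = 4 := by decide

/-- `S_odd = (Λ¹ ⊕ Λ³) W ⊗ det^{-1/2}` has dimension `4+4 = 8` and doubled charges `{2⁴, (-2)⁴}`. -/
theorem odd_weightOne :
    (chLamTw 1 ++ chLamTw 3).length = 8 ∧
    (chLamTw 1 ++ chLamTw 3).count 2 = 4 ∧ (chLamTw 1 ++ chLamTw 3).count (-2) = 4 := by decide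

/-- The pieces of `S_ev`: `Λ⁰` (charge `-1`: an elliptic curve `E'`), `Λ⁴` (charge `+1`: `E'` with the
conjugate type) and `Λ² W ⊗ det^{-1/2}` with doubled charges `{2³, (-2)³}`: a sixfold `B''` with
`K'`-signature `(3,3)`, i.e. of WEIL TYPE.  Hence `A_ev ~ E' × B'' × E'`. -/
theorem ev_pieces :
    chLamTw 0 = [-2] ∧ chLamTw 4 = [2] ∧
    (chLamTw 2).length = 6 ∧ (chLamTw 2).count 2 = 3 ∧ (chLamTw 2).count (-2) = 3 := by decide

/-- The pieces of `S_odd`: `Λ¹ W ⊗ det^{-1/2}` has doubled charges `{2, (-2)³}` (the `U(1,3)` fourfold `B'`,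
signature `(1,3)`) and `Λ³ W ⊗ det^{-1/2}` has `{2³, -2}` (the twist `B'^{tw}`, signature `(3,1)`).
Hence `A_odd ~ B' × B'^{tw} ~ B'²`. -/
theorem odd_pieces :
    (chLamTw 1).count 2 = 1 ∧ (chLamTw 1).count (-2) = 3 ∧
    (chLamTw 3).count 2 = 3 ∧ (chLamTw 3).count (-2) = 1 := by decide

/-- `K'`-signature bookkeeping of the sixfold `A₆ = B' × E' × E'`: `(1,3) + (1,0) + (1,0) = (3,3)` (Weil
type), while `B' × E'` alone has `(2,3)` (not Weil type: the first exceptional class lives on `A₆`). -/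
theorem weil_sixfold_signature :
    (1 + 1 + 1, 3 + 0 + 0) = ((3 : ℕ), (3 : ℕ)) ∧ (1 + 1, 3 + 0) ≠ ((3 : ℕ), (3 : ℕ)) := by decide

/-- The diagonal hermitian form `H_T = ⟨1,-1,-1,-1⟩` (Jacobson: forced by the trace form `U² ⊕ ⟨-1⟩⁴`). -/
def hT : List ℤ := [1, -1, -1, -1]

/-- Diagonal of `Λ² H_T`: the pairwise products `hᵢ hⱼ`, `i < j`. -/
def lam2Diag : List ℤ :=
  ((List.range 4).sublists.filter fun s => s.length = 2).map fun s => (s.map fun i => hT.getD i 0).prod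

/-- Determinant signs: `det H_T = -1`; `Λ² H_T` has diagonal `{(-1)³, 1³}` (signature `(3,3)`) and
determinant `-1`; `H_T ⊕ ⟨1,1⟩` has signature `(3,3)` and determinant `-1`.  Both sixfolds `B''` and
`B' × E'²` are of Weil type with discriminant `-1` (norms being squares up to `N(K'^×)`, the class of `-1`
is what matters). -/
theorem det_signs :
    hT.prod = -1 ∧ lam2Diag.count 1 = 3 ∧ lam2Diag.count (-1) = 3 ∧ lam2Diag.prod = -1 ∧
    (hT ++ [1, 1]).prod = -1 ∧ (hT ++ [1, 1]).count 1 = 3 ∧ (hT ++ [1, 1]).count (-1) = 3 := by decide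

/-- The character `(1,1,1,1,2)` (the relation `det g · u² = 1` on the diagonal torus of `GL(W) × 𝔾_m`) is
unimodular: it pairs to `1` with `(1,0,0,0,0)`, so `ℤ⁵/ℤ·(1,1,1,1,2)` is torsion-free and the group
`{det g · u² = 1}` is connected (used in the FFT step of KSγ). -/
theorem torus_primitive :
    List.sum (List.zipWith (· * ·) [1, 1, 1, 1, 2] [1, 0, 0, 0, 0]) = (1 : ℤ) := by decide

/-- On `U(1)` the Hodge cocharacter satisfies the relation: `det h(z) · u(z)² = z·z̄³·z² = z⁻²·z² = 1`,
recorded as the exponent identity `(1 - 3) + 2 = 0` for `z̄ = z⁻¹`. -/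
theorem hodge_in_Gprime : ((1 : ℤ) - 3) + 2 = 0 := by decide

end Summit.HodgeConjecture.HodgeConjecture.Theorems.LeviBranchingFour
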